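import Mathlib
import HarnessLib
import Literature.NumberTheory.LFunctions.ZetaScrew

/-!
# DBR column, rung B-P(P1): the «entries vs Λ(n)» dictionary of the lattice screw Hamiltonians —
# `c_j(s) = 32 sinh²(s/4) cosh(js/2) − Σ_n Λ(n) n^{−1/2} (s − |js − log n|)₊ − Σ_k e^{−λ_k js} sinh²(λ_k s/2)/(k+¼)²`

RH-FREE identity (LINE 1 of the label discipline): an exact formula, valid for EVERY mesh `s > 0` and every
lag `j ≥ 1`, for the Toeplitz entries of the increment Gram matrix of Suzuki's screw line sampled on a lattice,
read off the closed form Suzuki2023 (1.1) of `Ψ = Literature.NumberTheory.LFunctions.zetaScrew`. It locates no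
zero of `ζ`, asserts no sign, and is NOT worded as, and is not, progress toward RH.

Context (HOME `run/shared/lean/pub/rh-dbr/DATA/hm/HM.md` §4 (P1-e), seat rh-dbr-eng-2, 2026-08-26; LADDER-RH
B-P(P1) «RH-FREE identities for H_M in terms of prime sums»). On the arithmetic progression `log(q^K) + k·s`,
`s = log(p/q)`, inside the nodes `{log n}`, the increments of the screw line `x(log n)` (`‖x(t) − x(u)‖² = 2Ψ(t−u)`,
Suzuki arXiv:2209.04658) have the TOEPLITZ Gram matrix `T^{(r)}_K = [c_{|i−j|}(s)]`,
`c_j(s) = Ψ((j+1)s) − 2Ψ(js) + Ψ((j−1)s)` (second difference of `Ψ` at lag `j`, mesh `s`); the lattice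
Hamiltonians `H^{(r)} = diag(1/γ_m, γ_m)` of the cell's table (kit j250190) are the Levinson/Schur data of exactly
these numbers (Suzuki arXiv:1308.0228 Thm 1.1). THIS file is the dictionary «entries ↔ prime powers»:

* `latticeToeplitz_entry_eq` — for `s > 0`, `j ≥ 1` and any cut-off `M ≥ e^{(j+1)s}`,
  `c_j(s) = 32 sinh²(s/4)·cosh(js/2) − Σ_{n ≤ M} Λ(n) n^{−1/2}·max(s − |js − log n|, 0)
            − Σ_{k ≥ 0} e^{−(2k+½)js}·sinh²((2k+½)s/2)/(k+¼)²`: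
  ARCHIMEDEAN growth `+`, a TENT-smoothed sum over the prime powers within one mesh of `e^{js}` `−`, and a
  positive Hurwitz–Lerch decay term `−`. Only prime powers `n` with `|log n − js| < s` enter `c_j(s)`.
* `latticeToeplitz_entry_one_eq` — the lag-one entry (`j = 1`): `c₁(s) = Ψ(2s) − 2Ψ(s) + Ψ(0)`, whose
  negativity on `0 < s ≤ (log 2)/2` is `DbrWall.lagOne_increment_cov_neg` (there the tent sum is empty).

Method [folklore]: (1.1) split as `zetaScrew_eq` (archimedean `4(e^{t/2}+e^{−t/2}−2)`, prime sum, linear term,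
Lerch term) at the three nodes `(j±1)s, js ≥ 0`; the prime sums are truncated at the common cut-off `M` with
positive parts (`zetaScrewPrimeSum_eq_sum_max`) and the second difference of `t ↦ (t − log n)₊` is the tent
`(s − |js − log n|)₊` (`tent_second_difference`); the linear term cancels; the Lerch series is combined termwise
(`e^{−λt₊} − 2e^{−λt₀} + e^{−λt₋} = 4 e^{−λ js} sinh²(λs/2)`); the archimedean part is
`4(e^{js/2} + e^{−js/2})(e^{s/2} + e^{−s/2} − 2) = 32 sinh²(s/4) cosh(js/2)`.
References: M. Suzuki, J. Lond. Math. Soc. (2) 108 (2023) = arXiv:2206.03682, (1.1) [Suzuki2023]; M. Suzuki,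
J. Anal. Math. 136 (2018) = arXiv:1308.0228, Thm 1.1 [Suzuki2013]. Nothing here bears on the truth of RH. -/

set_option linter.dupNamespace false

noncomputable section

open scoped BigOperators
open Set
namespace Summit.RiemannHypothesis.RiemannHypothesis.Theorems.DbrLattice

open Literature.NumberTheory.LFunctions

/-- The second difference of the ramp `x ↦ max(x, 0)` with step `s ≥ 0` is the tent of height `s`:
`(x+s)₊ − 2x₊ + (x−s)₊ = (s − |x|)₊`. [folklore] -/
theorem tent_second_difference (x s : ℝ) (hs : 0 ≤ s) :
    max (x + s) 0 - 2 * max x 0 + max (x - s) 0 = max (s - |x|) 0 := by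
  rcases le_or_gt 0 x with hx | hx
  · rw [abs_of_nonneg hx, max_eq_left (by linarith : 0 ≤ x + s), max_eq_left hx]
    rcases le_or_gt s x with hsx | hsx
    · rw [max_eq_left (by linarith : 0 ≤ x - s), max_eq_right (by linarith : s - x ≤ 0)]; ring
    · rw [max_eq_right (by linarith : x - s ≤ 0), max_eq_left (by linarith : 0 ≤ s - x)]; ring
  · rw [abs_of_neg hx, max_eq_right hx.le, max_eq_right (by linarith : x - s ≤ 0)]
    rcases le_or_gt 0 (x + s) with hxs | hxs
    · rw [max_eq_left hxs, max_eq_left (by linarith : 0 ≤ s - -x)]; ring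
    · rw [max_eq_right hxs.le, max_eq_right (by linarith : s - -x ≤ 0)]; ring

/-- For `t ≥ 0` the Lerch term of (1.1) is one exponential series:
`e^{−t/2}·Φ(e^{−2t},2,¼) = Σ_k e^{−(2k+½)t}/(k+¼)²`. [folklore] -/
theorem exp_neg_half_mul_hurwitzLerchQuarter {t : ℝ} (ht : 0 ≤ t) :
    Real.exp (-(t / 2)) * hurwitzLerchQuarter t
      = ∑' k : ℕ, Real.exp (-((2 * k + 1 / 2) * t)) / ((k : ℝ) + 1 / 4) ^ 2 := by
  unfold hurwitzLerchQuarter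
  rw [abs_of_nonneg ht, ← tsum_mul_left]
  refine tsum_congr fun k => ?_
  rw [← mul_div_assoc, ← Real.exp_add]
  ring_nf

/-- The exponential series `Σ_k e^{−(2k+½)t}/(k+¼)²` converges for `t ≥ 0`. [folklore] -/
theorem summable_exp_neg_lam_mul_div {t : ℝ} (ht : 0 ≤ t) :
    Summable fun k : ℕ => Real.exp (-((2 * k + 1 / 2) * t)) / ((k : ℝ) + 1 / 4) ^ 2 := by
  refine summable_one_div_nat_add_quarter_sq.of_nonneg_of_le (fun k => by positivity) fun k => ?_
  apply div_le_div_of_nonneg_right _ (by positivity)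
  rw [Real.exp_le_one_iff, neg_nonpos]
  positivity

/-- Termwise second difference of the exponentials: `e^{−λ(js+s)} − 2e^{−λjs} + e^{−λ(js−s)} = 4e^{−λjs} sinh²(λs/2)`.
[folklore] -/
theorem exp_second_difference (l a s : ℝ) :
    Real.exp (-(l * (a + s))) - 2 * Real.exp (-(l * a)) + Real.exp (-(l * (a - s)))
      = 4 * Real.exp (-(l * a)) * Real.sinh (l * s / 2) ^ 2 := by
  rw [Real.sinh_eq]
  have h1 : Real.exp (-(l * (a + s))) = Real.exp (-(l * a)) * Real.exp (-(l * s / 2)) ^ 2 := by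
    rw [sq, ← Real.exp_add, ← Real.exp_add]; ring_nf
  have h2 : Real.exp (-(l * (a - s))) = Real.exp (-(l * a)) * Real.exp (l * s / 2) ^ 2 := by
    rw [sq, ← Real.exp_add, ← Real.exp_add]; ring_nf
  have h3 : Real.exp (l * s / 2) * Real.exp (-(l * s / 2)) = 1 := by
    rw [← Real.exp_add, add_neg_cancel, Real.exp_zero]
  rw [h1, h2]
  linear_combination (2 * Real.exp (-(l * a))) * h3

/-- **The «entries vs Λ(n)» dictionary** (RH-FREE identity). For every mesh `s > 0`, lag `j ≥ 1` and cut-off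
`M ≥ e^{(j+1)s}`:
`Ψ((j+1)s) − 2Ψ(js) + Ψ((j−1)s) = 32 sinh²(s/4) cosh(js/2) − Σ_{1≤n≤M} Λ(n) n^{−1/2} max(s − |js − log n|, 0)
  − Σ_{k≥0} e^{−(2k+½)js} sinh²((2k+½)s/2)/(k+¼)²`.
The lag-`j` increment covariance of the mesh-`s` lattice screw line is archimedean growth minus the tent-smoothed
prime powers within one mesh of `e^{js}` minus a Lerch decay term. [folklore] -/
theorem latticeToeplitz_entry_eq {s : ℝ} (hs : 0 < s) {j : ℕ} (hj : 1 ≤ j) {M : ℕ}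
    (hM : Real.exp (((j : ℝ) + 1) * s) ≤ M) :
    zetaScrew (((j : ℝ) + 1) * s) - 2 * zetaScrew ((j : ℝ) * s) + zetaScrew (((j : ℝ) - 1) * s)
      = 32 * Real.sinh (s / 4) ^ 2 * Real.cosh ((j : ℝ) * s / 2)
        - (∑ n ∈ Finset.Icc 1 M, ArithmeticFunction.vonMangoldt n / Real.sqrt n
            * max (s - |(j : ℝ) * s - Real.log n|) 0)
        - ∑' k : ℕ, Real.exp (-((2 * k + 1 / 2) * ((j : ℝ) * s)))
            * Real.sinh ((2 * k + 1 / 2) * s / 2) ^ 2 / ((k : ℝ) + 1 / 4) ^ 2 := by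
  have hj1 : (1 : ℝ) ≤ j := by exact_mod_cast hj
  -- the three nodes are non-negative
  have h0p : 0 ≤ ((j : ℝ) + 1) * s := by positivity
  have h00 : 0 ≤ (j : ℝ) * s := by positivity
  have h0m : 0 ≤ ((j : ℝ) - 1) * s := mul_nonneg (by linarith) hs.le
  -- cut-offs
  have hMp : Real.exp |((j : ℝ) + 1) * s| ≤ M := by rwa [abs_of_nonneg h0p]
  have hM0 : Real.exp |(j : ℝ) * s| ≤ M := by
    rw [abs_of_nonneg h00]; exact (Real.exp_le_exp.2 (by nlinarith)).trans hM
  have hMm : Real.exp |((j : ℝ) - 1) * s| ≤ M := by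
    rw [abs_of_nonneg h0m]; exact (Real.exp_le_exp.2 (by nlinarith)).trans hM
  rw [zetaScrew_eq (((j : ℝ) + 1) * s), zetaScrew_eq ((j : ℝ) * s), zetaScrew_eq (((j : ℝ) - 1) * s),
    zetaScrewPrimeSum_eq_sum_max hMp, zetaScrewPrimeSum_eq_sum_max hM0, zetaScrewPrimeSum_eq_sum_max hMm,
    abs_of_nonneg h0p, abs_of_nonneg h00, abs_of_nonneg h0m]
  -- the prime sums: tent identity termwise
  have hP : (∑ n ∈ Finset.Icc 1 M, ArithmeticFunction.vonMangoldt n / Real.sqrt n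
        * max (((j : ℝ) + 1) * s - Real.log n) 0)
      - 2 * (∑ n ∈ Finset.Icc 1 M, ArithmeticFunction.vonMangoldt n / Real.sqrt n
        * max ((j : ℝ) * s - Real.log n) 0)
      + (∑ n ∈ Finset.Icc 1 M, ArithmeticFunction.vonMangoldt n / Real.sqrt n
        * max (((j : ℝ) - 1) * s - Real.log n) 0)
      = ∑ n ∈ Finset.Icc 1 M, ArithmeticFunction.vonMangoldt n / Real.sqrt n
        * max (s - |(j : ℝ) * s - Real.log n|) 0 := by
    rw [Finset.mul_sum, ← Finset.sum_sub_distrib, ← Finset.sum_add_distrib]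
    refine Finset.sum_congr rfl fun n _ => ?_
    have ht := tent_second_difference ((j : ℝ) * s - Real.log n) s hs.le
    rw [show ((j : ℝ) + 1) * s - Real.log n = (j : ℝ) * s - Real.log n + s by ring,
      show ((j : ℝ) - 1) * s - Real.log n = (j : ℝ) * s - Real.log n - s by ring, ← ht]
    ring
  -- the Lerch terms
  have hLp := exp_neg_half_mul_hurwitzLerchQuarter h0p
  have hL0 := exp_neg_half_mul_hurwitzLerchQuarter h00
  have hLm := exp_neg_half_mul_hurwitzLerchQuarter h0m
  have hSp := summable_exp_neg_lam_mul_div h0p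
  have hS0 := summable_exp_neg_lam_mul_div h00
  have hSm := summable_exp_neg_lam_mul_div h0m
  have hL : Real.exp (-(((j : ℝ) + 1) * s / 2)) * hurwitzLerchQuarter (((j : ℝ) + 1) * s)
      - 2 * (Real.exp (-((j : ℝ) * s / 2)) * hurwitzLerchQuarter ((j : ℝ) * s))
      + Real.exp (-(((j : ℝ) - 1) * s / 2)) * hurwitzLerchQuarter (((j : ℝ) - 1) * s)
      = 4 * ∑' k : ℕ, Real.exp (-((2 * k + 1 / 2) * ((j : ℝ) * s)))
            * Real.sinh ((2 * k + 1 / 2) * s / 2) ^ 2 / ((k : ℝ) + 1 / 4) ^ 2 := by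
    rw [hLp, hL0, hLm, ← tsum_mul_left, ← hSp.tsum_sub (hS0.mul_left 2),
      ← (hSp.sub (hS0.mul_left 2)).tsum_add hSm, ← tsum_mul_left]
    refine tsum_congr fun k => ?_
    have he := exp_second_difference (2 * k + 1 / 2) ((j : ℝ) * s) s
    rw [show (2 * (k : ℝ) + 1 / 2) * (((j : ℝ) + 1) * s) = (2 * k + 1 / 2) * ((j : ℝ) * s + s) by ring,
      show (2 * (k : ℝ) + 1 / 2) * (((j : ℝ) - 1) * s) = (2 * k + 1 / 2) * ((j : ℝ) * s - s) by ring]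
    linear_combination (1 / ((k : ℝ) + 1 / 4) ^ 2) * he
  -- the archimedean part via `A = e^{js/2}`, `C = e^{s/4}`
  set A : ℝ := Real.exp ((j : ℝ) * s / 2) with hA
  set A' : ℝ := Real.exp (-((j : ℝ) * s / 2)) with hA'
  set C : ℝ := Real.exp (s / 4) with hC
  set C' : ℝ := Real.exp (-(s / 4)) with hC'
  have hCC : C * C' = 1 := by rw [hC, hC', ← Real.exp_add, add_neg_cancel, Real.exp_zero]
  have e1 : Real.exp (((j : ℝ) + 1) * s / 2) = A * C ^ 2 := by
    rw [hA, hC, sq, ← Real.exp_add, ← Real.exp_add]; ring_nf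
  have e2 : Real.exp (-(((j : ℝ) + 1) * s / 2)) = A' * C' ^ 2 := by
    rw [hA', hC', sq, ← Real.exp_add, ← Real.exp_add]; ring_nf
  have e3 : Real.exp (((j : ℝ) - 1) * s / 2) = A * C' ^ 2 := by
    rw [hA, hC', sq, ← Real.exp_add, ← Real.exp_add]; ring_nf
  have e4 : Real.exp (-(((j : ℝ) - 1) * s / 2)) = A' * C ^ 2 := by
    rw [hA', hC, sq, ← Real.exp_add, ← Real.exp_add]; ring_nf
  have hsinh : Real.sinh (s / 4) = (C - C') / 2 := by rw [Real.sinh_eq]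
  have hcosh : Real.cosh ((j : ℝ) * s / 2) = (A + A') / 2 := by rw [Real.cosh_eq]
  rw [hsinh, hcosh]
  simp only [e1, e2, e3, e4] at hL ⊢
  linear_combination (-1 : ℝ) * hP - (1 / 4 : ℝ) * hL + (8 * (A + A')) * hCC

/-- **Lag one** (`j = 1`): for every mesh `s > 0` and cut-off `M ≥ e^{2s}`,
`c₁(s) = Ψ(2s) − 2Ψ(s) + Ψ(0) = 32 sinh²(s/4) cosh(s/2) − Σ_{n≤M} Λ(n) n^{−1/2} max(s − |s − log n|, 0)
  − Σ_k e^{−(2k+½)s} sinh²((2k+½)s/2)/(k+¼)²`; on the prime-free wall `2s ≤ log 2` the tent sum is empty and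
`c₁(s) < 0` (`DbrWall.lagOne_increment_cov_neg`). [folklore] -/
theorem latticeToeplitz_entry_one_eq {s : ℝ} (hs : 0 < s) {M : ℕ} (hM : Real.exp (2 * s) ≤ M) :
    zetaScrew (2 * s) - 2 * zetaScrew s + zetaScrew 0
      = 32 * Real.sinh (s / 4) ^ 2 * Real.cosh (s / 2)
        - (∑ n ∈ Finset.Icc 1 M, ArithmeticFunction.vonMangoldt n / Real.sqrt n
            * max (s - |s - Real.log n|) 0)
        - ∑' k : ℕ, Real.exp (-((2 * k + 1 / 2) * s))
            * Real.sinh ((2 * k + 1 / 2) * s / 2) ^ 2 / ((k : ℝ) + 1 / 4) ^ 2 := by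
  have h := latticeToeplitz_entry_eq hs (le_refl 1) (M := M) (by push_cast; rwa [show ((1:ℝ) + 1) * s = 2 * s by ring])
  push_cast at h
  simp only [one_mul, sub_self, zero_mul, show ((1 : ℝ) + 1) * s = 2 * s by ring] at h
  exact h

end Summit.RiemannHypothesis.RiemannHypothesis.Theorems.DbrLattice
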